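import Literature.Barriers.CriticalPhenomena.RigorousRGSmallParameterHHWBleherSinai
import Literature.Barriers.CriticalPhenomena.RigorousRGSmallParameterNarrowReduction
import HarnessLib

/-!
# HHW Theorem 1.1 and the narrowed barrier from Theorem 2.2 and the strip condition

Assembly on the Hara–Hattori–Watanabe side of `RigorousRGSmallParameterNarrow`
(`= Slade2017_thm141 ∧ HaraHattoriWatanabe2001_thm11`). With
`HierarchicalRG.HaraHattoriWatanabe2001_thm21_corrected_holds` (`…HHWBleherSinai`: Theorem 2.1 in
the form its printed proof establishes, PROVED) and `HaraHattoriWatanabe2001_eqA1_holds`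
(`…HHWNewman`, PROVED), the p. 6 argument of the paper ("Proof of Theorem 1.1 for `d = 4` assuming
Theorem 2.1 and Theorem 2.2": `μ_{4,N} → 0`, `μ_{2,N} → 1` at `s_c`, then (A.1) and Lévy, as in
`HaraHattoriWatanabe2001_thm11_of_parts`) gives:

* **`HaraHattoriWatanabe2001_thm11_of_thm22_of_strip`** — Theorem 1.1 from Theorem 2.2
  (`HaraHattoriWatanabe2001_thm22`; the tree derives it from Newman's bound (A.6), now proved, and
  the compiler-checked certificate of §5, `…HHWThm22`) and the critical-mass strip condition
  `HierarchicalRG.Thm21StripHypothesis 70 100` ((2.13) at the levels `70 ≤ N < 100` on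
  `[s̲₁₀₀, s̄₁₀₀]`, certified by the computation of `…HHWStripCert`; see `…HHWThm21Statement` for why
  the printed proof of Theorem 2.1 needs it);
* **`rigorousRGSmallParameterNarrow_of_criticalCurve_of_thm22_of_strip`** — the narrowed barrier
  from Slade's critical curve (`LongRangePhi4.Slade2017_criticalCurve`, the remaining leaf on the
  long-range side), Theorem 2.2 and the strip condition.

Both are axiom-clean (the certificate enters only through the hypotheses).

## References

* T. Hara, T. Hattori, H. Watanabe, Comm. Math. Phys. 220 (2001) 13–40, Theorems 1.1, 2.1, 2.2
  (p. 6), Appendix A.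
* G. Slade, Comm. Math. Phys. 358 (2018) 343–436, Theorem 1.4.1.
-/

noncomputable section

namespace Literature.Barriers.CriticalPhenomena

open _root_.MeasureTheory _root_.ProbabilityTheory _root_.Filter _root_.Set
open scoped _root_.Topology

/-- **HHW Theorem 1.1 from Theorem 2.2 and the strip condition**: the corrected Theorem 2.1
(proved) gives `s_c ∈ [s̲₁₀₀, s̄₁₀₀]` with `μ_{4,N} → 0`, `μ_{2,N} → 1`; then `ĥ_N → e^{-ξ²}` by (A.1)
(proved) and weak convergence by Lévy — the proof on p. 6.
[cite: HaraHattoriWatanabe2001, Theorem 1.1 (proof, p. 6)] -/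
theorem HaraHattoriWatanabe2001_thm11_of_thm22_of_strip (h22 : HaraHattoriWatanabe2001_thm22)
    (hstrip : HierarchicalRG.Thm21StripHypothesis 70 100) : HaraHattoriWatanabe2001_thm11 := by
  obtain ⟨hhyp, hlow, -⟩ := h22
  obtain ⟨s_c, ⟨hsc1, -⟩, h4, h2⟩ :=
    HierarchicalRG.HaraHattoriWatanabe2001_thm21_corrected_holds 70 100 (by norm_num) hhyp hstrip
  have hs_pos : 0 < s_c := lt_of_lt_of_le (by norm_num) (hlow.trans hsc1)
  refine ⟨s_c, hs_pos, fun g => ?_⟩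
  let μs : ℕ → ProbabilityMeasure ℝ := fun N => ⟨HierarchicalRG.traj s_c N, inferInstance⟩
  let μ0 : ProbabilityMeasure ℝ := ⟨gaussianReal 0 2, inferInstance⟩
  have hconv : Tendsto μs atTop (𝓝 μ0) := by
    apply ProbabilityMeasure.tendsto_of_tendsto_charFun
    intro t
    have h := HierarchicalRG.tendsto_charFun_traj HaraHattoriWatanabe2001_eqA1_holds hs_pos.le h2 h4 t
    have e : charFun (μ0 : Measure ℝ) t = ((Real.exp (-t ^ 2) : ℝ) : ℂ) := by
      change charFun (gaussianReal 0 2) t = _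
      rw [charFun_gaussianReal]
      push_cast
      congr 1
      ring
    rw [e]
    exact h
  exact (ProbabilityMeasure.tendsto_iff_forall_integral_tendsto.1 hconv) g

/-- **The narrowed barrier `RigorousRGSmallParameterNarrow` from Slade's critical curve, Theorem 2.2
and the strip condition** — everything else on the Hara–Hattori–Watanabe side being proved.
[cite: HaraHattoriWatanabe2001, Theorem 1.1] [cite: Slade2017, Theorem 1.4.1] -/
theorem rigorousRGSmallParameterNarrow_of_criticalCurve_of_thm22_of_strip
    (hS : LongRangePhi4.Slade2017_criticalCurve) (h22 : HaraHattoriWatanabe2001_thm22)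
    (hstrip : HierarchicalRG.Thm21StripHypothesis 70 100) : RigorousRGSmallParameterNarrow :=
  rigorousRGSmallParameterNarrow_of_thm141_of_thm11 (rigorousRGSmallParameter_of_criticalCurve hS)
    (HaraHattoriWatanabe2001_thm11_of_thm22_of_strip h22 hstrip)

end Literature.Barriers.CriticalPhenomena
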